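import Summits.CriticalPhenomena.PercolationContinuityZ3.Theorems.PercNearOneGluingNoHeavyLowerTailSahiThreeCopyLawBackRelab
import Summits.CriticalPhenomena.PercolationContinuityZ3.Theorems.PercNearOneGluingNoHeavyLowerTailSahiThreeCopyLawBackSplit
import Literature.Combinatorics.Sahi2008.CumulationCone

/-!
# `NoHeavyLowerTail` (crux stmt-CriticalPhenomena-4575), Sahi programme: slots on ARBITRARY coordinates — placement-free form of the law-level `E₃ ≥ 0`

Support file (Sahi cell, seat `prim-sahi-p1`, generation 65; `--supports stmt-CriticalPhenomena-4575`).  Pure bookkeeping.  The slot theorems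
(`lawGood_C6_all`, `lawGood_C8_all`, …) are stated for a slot `f` read on the FIRST `k` coordinates of the cube `{0,1}^{d+k}` (`frontFn k f`).  Relabelling the
cube by any permutation `σ` of the `d+k` coordinates transports the product (coin) weight to another product weight (`coinWeight_comp_relab`) and monotone
`[0,1]`-valued `G, H` to functions of the same kind, while `E₃` is invariant under relabelling the lattice (`sahiE_comp_equiv`, Literature).  Hence
`sahiE_three_coin_relab_nonneg_of_lawGood`: if `LawGood k π f` holds at every front profile then `0 ≤ E₃^{coin Q}(frontFn k f ∘ relab σ, G, H)` for EVERY
`σ` — the slot may sit on any `k` coordinates, in any order. [this work]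
-/

namespace Summit.CriticalPhenomena.PercolationContinuityZ3.Theorems.SahiThreeCopy

open Finset Function Literature.Combinatorics.Sahi2008
open scoped BigOperators

variable {n : ℕ}

/-- The coin weight transported along a coordinate relabelling is the coin weight of the relabelled biases:
`coinWeight Q (y ∘ σ) = coinWeight (Q ∘ σ⁻¹) y`. [this work] -/
theorem coinWeight_comp_relab (Q : Fin n → ℝ) (σ : Equiv.Perm (Fin n)) :
    coinWeight Q ∘ relab σ = coinWeight (Q ∘ σ.symm) := by
  funext y
  simp only [Function.comp_apply, coinWeight, relab_apply]
  exact Fintype.prod_equiv σ (fun i => if y (σ i) then Q i else 1 - Q i)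
    (fun j => if y j then Q (σ.symm j) else 1 - Q (σ.symm j)) (fun i => by simp only [Equiv.symm_apply_apply])

/-- ★ **Placement-free law-level `E₃ ≥ 0`.**  If the slot `f` on `k` coordinates is law-good at every front profile, then for every `d`, every
permutation `σ` of the `d+k` coordinates, every `Q ∈ [0,1]^{d+k}` and all monotone `[0,1]`-valued `G, H`:
`0 ≤ E₃^{coin Q}(frontFn k f ∘ relab σ, G, H)`. [this work] -/
theorem sahiE_three_coin_relab_nonneg_of_lawGood {k : ℕ} {f : Pt k → ℝ} (hgood : ∀ π : Fin k → ℕ, LawGood k π f) {d : ℕ}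
    (σ : Equiv.Perm (Fin (d + k))) {Q : Fin (d + k) → ℝ} (hQ : ∀ i, 0 ≤ Q i ∧ Q i ≤ 1) {G H : Pt (d + k) → ℝ}
    (hG : ∀ w, 0 ≤ G w) (hG1 : ∀ w, G w ≤ 1) (hH : ∀ w, 0 ≤ H w) (hH1 : ∀ w, H w ≤ 1) (hGm : Monotone G) (hHm : Monotone H) :
    0 ≤ sahiE (coinWeight Q) 3 ![frontFn k f ∘ relab σ, G, H] := by
  -- the relabelled biases Q' = Q ∘ σ: coinWeight Q = coinWeight Q' ∘ relab σ
  have hQ' : ∀ i, 0 ≤ (Q ∘ σ) i ∧ (Q ∘ σ) i ≤ 1 := fun i => hQ (σ i)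
  have hw : coinWeight Q = coinWeight (Q ∘ σ) ∘ relab σ := by
    rw [coinWeight_comp_relab]
    congr 1; funext i; simp only [Function.comp_apply, Equiv.apply_symm_apply]
  have key := sahiE_comp_equiv (relab σ) (coinWeight (Q ∘ σ)) 3 ![frontFn k f, G ∘ relab σ.symm, H ∘ relab σ.symm]
  have hfun : (fun i => (![frontFn k f, G ∘ relab σ.symm, H ∘ relab σ.symm] : Fin 3 → Pt (d + k) → ℝ) i ∘ relab σ)
      = ![frontFn k f ∘ relab σ, G, H] := by
    funext i; fin_cases i
    · rfl
    · exact comp_relab_symm_relab σ G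
    · exact comp_relab_symm_relab σ H
  rw [hfun, ← hw] at key
  rw [key]
  exact sahiE_three_coin_frontFn_nonneg_of_lawGood hgood hQ' (fun w => hG _) (fun w => hG1 _) (fun w => hH _) (fun w => hH1 _)
    (monotone_comp_relab σ.symm hGm) (monotone_comp_relab σ.symm hHm)

end Summit.CriticalPhenomena.PercolationContinuityZ3.Theorems.SahiThreeCopy
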